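import Summits.QuantumFields.YangMills.Theorems.UnitScaleTiltProp7H46GradRowT3
import Summits.QuantumFields.YangMills.Theorems.UnitScaleTiltProp7SectET3EXJunctionRowsT3
import Summits.QuantumFields.YangMills.Theorems.UnitScaleTiltProp7H46RealityClause
import Summits.QuantumFields.YangMills.Theorems.UnitScaleTiltProp7SPrintDefsS
import HarnessLib

/-!
# Route `UnitScaleTilt`, crux «MinimiserStabilityRegPr» (stmt-QuantumFields-19200, stub EX `stub_existenceMinimalOrbit`), route (α), node N06(d = 3) —
# **THE EX BINDER `h46tw` OF THE KNIT OF RECORD, VERBATIM (∃ H, four clauses), FOR THE LETTER OF RECORD `H := H46 U₀`, FROM THREE NAMED ROWS: the N06 input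
# `RegPr → PosOnto(Δ_π) ∧ PosPrime` ([B9] Thm 3.11), the `norm_H₁`-shaped (115)-norm row `norm_H` for `H1f … (Δ_π-slot)` ([B9] Thm 3.12 ∕ (3.133)), and the two (WF) windows**
# — plus the five-clause twin `h46twGrad_of_N06_normH` carrying the gradient row (46)₁ (`h46∇`) inside the `∃ H` (★px5 g0's cure (β) shape).

Cell `ym3-torus` (HUMAN RULING D-0037, YM ladder rung R3 — YM₃ on T³ is a rung, NOT d = 4, NOT a mass gap, NOT Clay), width seat `ym3-torus-px18` (gen 0).
THEOREMS ONLY (0 `def`, 0 `sorry`); `--supports stmt-QuantumFields-19200 --as helper`; count-neutral.  An ASSEMBLY of landed rows: (45)₁ ✓`Prop7SectET3CurvedPropagators.QTwS_Hf`,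
(45)₂ ✓`Prop7SectET3DeltaPi.landauS_H46` + ✓`Prop7SPrint.isLandauPrintS_iff_RS`, (46)₀∕(46)₁ ✓`Prop7H46GradRow.h46_rows_H46_of_norm115` (this seat), reality ✓`Prop7H46RealityClause.
H46_skewHermitian_traceless_at_regPr`.  Nothing of [Balaban1985Variational] ∕ [Balaban1985BackgroundPropagators] is asserted; the two N06 rows stay DISPLAYED.

THE PRINT.  [Balaban1985Variational] (45)–(46) p. 285 (`LʲηQ_jHB = B`, `R(U₀)D*_{U₀}HB = 0`, `|HB|, |∇_{U₀}HB| ≤ B₀|B|`) for `H = GQ*(QGQ*)⁻¹` ([Balaban1985BackgroundPropagators] (3.126) p. 420,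
Thm 3.11 p. 418, Thm 3.12 ∕ (3.133) p. 422); the knit of record ✓`Prop7StubEXOfChartPiecesTwS6.stubEX_of_chartPiecesTwS6` displays them as `h46tw` (:108–113) with `H` EXISTENTIALLY bound.

WHAT IS PROVED (ns `…Theorems.Prop7H46TwOfN06`).  ★★★`h46tw_of_N06_normH` — the binder text of `h46tw` quantifier for quantifier (`BH := B₀`; weights `c₀ cB : ℕ → ℝ` as displayed, `a` free and
member-indexed) with the witness `H := H46 i.1.1 i.1.2.1 i.1.2.2 i.2.2.le (c₀ L) (cB L) (a L i) U₀`; ★★★`h46twGrad_of_N06_normH` — the same with a fifth conjunct, the gradient row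
`∀ Y μ ν x, ‖covGradT 1 (bgUnits U₀) (H Y) μ ν x‖ ≤ B₀ L * η² * ‖Y‖`; ★`h46tw_letter_of_N06_normH` — the four rows for the NAMED letter without the `∃` (cure (α) shape).
HONEST SCOPE.  Assembly; the N06 rows `hN06` (positivity ∕ onto on the regular class) and `norm_H` (the (115)-norm of print's `H`) are displayed hypotheses with the cell's suppliers of record
(✓`Prop7SectET3EXJunction.h45_pi_of_N06` currency; KH1 ✓`Prop7SectET3NormHRowAtOpsT3.normH₁_row_at_opsT3`, `Hsel := Hk`); nothing here claims EX, the crux, V3∕R3, d = 4 or the mass gap.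

References: T. Bałaban, CMP **102** (1985) 277–309 [Balaban1985Variational] ((45)–(46) p.285, (21) p.281, (51) p.286, (115) p.294); CMP **99** (1985) 389–434
[Balaban1985BackgroundPropagators] (Thm 3.11 p.418, (3.110) p.417, (3.126) p.420, (3.133) p.422).
-/

set_option autoImplicit false

noncomputable section

open scoped Matrix.Norms.L2Operator BigOperators

namespace Summit.QuantumFields.YangMills.Theorems.Prop7H46TwOfN06

open Literature.MathematicalPhysics.QuantumFieldTheory.Balaban1983to89
open Literature.MathematicalPhysics.QuantumFieldTheory.Balaban1983to89.T3ContinuumYM3Torus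
open Literature.MathematicalPhysics.QuantumFieldTheory.Balaban1983to89.T3Thm1Carrier (Idx)
open Literature.MathematicalPhysics.QuantumFieldTheory.Balaban1983to89.T3PrintedRegularMinimiser (RegPr)
open T3SectALandauChart (eta eta_pos bgUnits covGradT)
open B9SectCLatticeCarrier (Bond)
open B11Eq103H1Complex (BondL2K)
open Summit.QuantumFields.YangMills.Theorems.Prop7SectET3Transport (periodsT3 bondEquiv bgOfCfg)
open Summit.QuantumFields.YangMills.Theorems.Prop7SectET3HilbertLetters (W₂ toL2 toL2B DstarL2)
open Summit.QuantumFields.YangMills.Theorems.Prop7SectET3GaugeProjector (RS)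
open Summit.QuantumFields.YangMills.Theorems.Prop7SymAvgTwSym (QTwS)
open Summit.QuantumFields.YangMills.Theorems.Prop7SPrint (IsLandauPrintS isLandauPrintS_iff_RS)
open Summit.QuantumFields.YangMills.Theorems.Prop7SectET3CurvedPropagators
open Summit.QuantumFields.YangMills.Theorems.Prop7SectET3DeltaPi (PosPrime DeltaPiSlot H46 landauS_H46)
open Summit.QuantumFields.YangMills.Theorems.Prop7H46RealityClause (H46_skewHermitian_traceless_at_regPr)
open Summit.QuantumFields.YangMills.Theorems.Prop7H46GradRow (h46_rows_H46_of_norm115)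

variable [hFL : ∀ F : T3Family, Fact (0 < (F.L : ℝ))] [hFη : ∀ (F : T3Family) (k : ℕ), Fact (0 < ((F.L : ℝ)⁻¹) ^ k)]
variable {α : ℕ → ℝ} {c₀ cB : ℕ → ℝ} [hc₀ : ∀ L : ℕ, Fact (0 < c₀ L)] [hcB : ∀ L : ℕ, Fact (0 < cB L)] {a : ∀ L : ℕ, Idx L → ℝ} {ef B₀ : ℕ → ℝ}

/-- ★ **THE FOUR ROWS OF `h46tw` FOR THE NAMED LETTER `H46 U₀` (no `∃`; ★px5 g0's cure (α) shape), + the gradient row**: under `RegPr … (α L) U₀`, (45)₁ `QTwS U₀ (H46 Y) = Y`, (45)₂ˢ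
`IsLandauPrintS (c₀ L) (cB L) U₀ (H46 Y)`, (46)₀ `‖H46 Y‖ ≤ B₀ L·η·‖Y‖`, (46)₁ `‖covGradT 1 (bgUnits U₀) (H46 Y) μ ν x‖ ≤ B₀ L·η²·‖Y‖`, reality — from `hN06`, `norm_H` and the (WF) windows.
[cite: Balaban1985Variational, (45)–(46) p.285, (21) p.281, (51) p.286; Balaban1985BackgroundPropagators, Thm 3.11 p.418, (3.126) p.420, (3.133) p.422] -/
theorem h46tw_letter_of_N06_normH (hα : ∀ L, 1 < L → 0 < α L) (hef : ∀ L, 1 < L → 0 < ef L)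
    (hWe : ∀ L : ℕ, 1 < L → 10 ^ 9 * (L : ℝ) ^ 2 * ef L ≤ 1) (hWε : ∀ L : ℕ, 1 < L → 10 ^ 12 * (L : ℝ) ^ 3 * α L ≤ 1)
    (hN06 : ∀ (L : ℕ), 1 < L → ∀ (i : Idx L) (U₀ : GaugeField (i.1.1.P i.1.2.2) 0 (Matrix.specialUnitaryGroup (Fin 2) ℂ)), RegPr i.1.1 i.1.2.1 i.1.2.2 (α L) U₀ →
      PosOnto i.1.1 i.1.2.1 i.1.2.2 i.2.2.le (c₀ L) (cB L) (a L i) (DeltaPiSlot i.1.1 i.1.2.1 i.1.2.2 i.2.2.le (c₀ L) (cB L) (a L i)) U₀ ∧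
      PosPrime i.1.1 i.1.2.1 i.1.2.2 i.2.2.le (c₀ L) (cB L) (a L i) U₀)
    (norm_H : ∀ (L : ℕ), 1 < L → ∀ (i : Idx L) (ρ : ℝ) (U₀ : GaugeField (i.1.1.P i.1.2.2) 0 (Matrix.specialUnitaryGroup (Fin 2) ℂ)),
      RegPr i.1.1 i.1.2.1 i.1.2.2 ρ U₀ → ρ ≤ α L →
        ∀ b, ‖H1f i.1.1 i.1.2.1 i.1.2.2 i.2.2.le (c₀ L) (cB L) (a L i) (DeltaPiSlot i.1.1 i.1.2.1 i.1.2.2 i.2.2.le (c₀ L) (cB L) (a L i)) U₀ b‖ ≤ B₀ L * ‖b‖) :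
    ∀ (L : ℕ), 1 < L → ∀ (i : Idx L) (U₀ : GaugeField (i.1.1.P i.1.2.2) 0 (Matrix.specialUnitaryGroup (Fin 2) ℂ)), RegPr i.1.1 i.1.2.1 i.1.2.2 (α L) U₀ →
      (∀ Y, QTwS i.1.1 i.1.2.1 i.1.2.2 i.2.2.le U₀ (H46 i.1.1 i.1.2.1 i.1.2.2 i.2.2.le (c₀ L) (cB L) (a L i) U₀ Y) = Y) ∧
      (∀ Y, IsLandauPrintS i.1.1 i.1.2.1 i.1.2.2 i.2.2.le (c₀ L) (cB L) U₀ (H46 i.1.1 i.1.2.1 i.1.2.2 i.2.2.le (c₀ L) (cB L) (a L i) U₀ Y)) ∧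
      (∀ Y, ‖H46 i.1.1 i.1.2.1 i.1.2.2 i.2.2.le (c₀ L) (cB L) (a L i) U₀ Y‖ ≤ B₀ L * eta i.1.1 i.1.2.1 i.1.2.2 * ‖Y‖) ∧
      (∀ (Y : PBond (i.1.1.P i.1.2.1) 0 → Matrix (Fin 2) (Fin 2) ℂ) (μ ν : Fin (i.1.1.P i.1.2.2).d) (x : Site (i.1.1.P i.1.2.2) 0),
        ‖covGradT 1 (bgUnits i.1.1 i.1.2.2 U₀) (H46 i.1.1 i.1.2.1 i.1.2.2 i.2.2.le (c₀ L) (cB L) (a L i) U₀ Y) μ ν x‖ ≤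
          B₀ L * eta i.1.1 i.1.2.1 i.1.2.2 ^ 2 * ‖Y‖) ∧
      (∀ Y, (∀ c, star (Y c) = -Y c ∧ (Y c).trace = 0) →
        ∀ b', star (H46 i.1.1 i.1.2.1 i.1.2.2 i.2.2.le (c₀ L) (cB L) (a L i) U₀ Y b') = -H46 i.1.1 i.1.2.1 i.1.2.2 i.2.2.le (c₀ L) (cB L) (a L i) U₀ Y b' ∧
          (H46 i.1.1 i.1.2.1 i.1.2.2 i.2.2.le (c₀ L) (cB L) (a L i) U₀ Y b').trace = 0) := by
  intro L hL i U₀ hU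
  obtain ⟨hp, hq⟩ := hN06 L hL i U₀ hU
  have h46 := h46_rows_H46_of_norm115 i.1.1 i.1.2.1 i.1.2.2 i.2.2.le (c₀ L) (cB L) (a L i) U₀ (norm_H L hL i (α L) U₀ hU le_rfl)
  have hLc : (i.1.1.L : ℝ) = (L : ℝ) := by rw [i.2.1]
  have hWe' : 10 ^ 9 * (i.1.1.L : ℝ) ^ 2 * ef L ≤ 1 := by rw [hLc]; exact hWe L hL
  have hWε' : 10 ^ 12 * (i.1.1.L : ℝ) ^ 3 * α L ≤ 1 := by rw [hLc]; exact hWε L hL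
  refine ⟨fun Y => QTwS_Hf hp Y, fun Y => ?_, h46.1, h46.2, ?_⟩
  · exact (isLandauPrintS_iff_RS U₀ _).mpr (landauS_H46 hp hq Y)
  · exact H46_skewHermitian_traceless_at_regPr i.1.1 i.2.2.le (c₀ L) (cB L) (a L i) (hα L hL) (hef L hL) hWe' hWε' U₀ hU

/-- ★★★ **THE EX BINDER `h46tw` OF ✓`Prop7StubEXOfChartPiecesTwS6`, VERBATIM (`∃ H`, four clauses, `BH := B₀`), FROM THE N06 INPUT, THE (115)-NORM ROW OF PRINT'S `H` AND THE (WF) WINDOWS**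
— witness `H := H46 U₀` (the letter of record). [cite: Balaban1985Variational, (45)–(46) p.285, (21) p.281, (51) p.286; Balaban1985BackgroundPropagators, Thm 3.11 p.418, (3.126) p.420, (3.133) p.422] -/
theorem h46tw_of_N06_normH (hα : ∀ L, 1 < L → 0 < α L) (hef : ∀ L, 1 < L → 0 < ef L)
    (hWe : ∀ L : ℕ, 1 < L → 10 ^ 9 * (L : ℝ) ^ 2 * ef L ≤ 1) (hWε : ∀ L : ℕ, 1 < L → 10 ^ 12 * (L : ℝ) ^ 3 * α L ≤ 1)
    (hN06 : ∀ (L : ℕ), 1 < L → ∀ (i : Idx L) (U₀ : GaugeField (i.1.1.P i.1.2.2) 0 (Matrix.specialUnitaryGroup (Fin 2) ℂ)), RegPr i.1.1 i.1.2.1 i.1.2.2 (α L) U₀ →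
      PosOnto i.1.1 i.1.2.1 i.1.2.2 i.2.2.le (c₀ L) (cB L) (a L i) (DeltaPiSlot i.1.1 i.1.2.1 i.1.2.2 i.2.2.le (c₀ L) (cB L) (a L i)) U₀ ∧
      PosPrime i.1.1 i.1.2.1 i.1.2.2 i.2.2.le (c₀ L) (cB L) (a L i) U₀)
    (norm_H : ∀ (L : ℕ), 1 < L → ∀ (i : Idx L) (ρ : ℝ) (U₀ : GaugeField (i.1.1.P i.1.2.2) 0 (Matrix.specialUnitaryGroup (Fin 2) ℂ)),
      RegPr i.1.1 i.1.2.1 i.1.2.2 ρ U₀ → ρ ≤ α L →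
        ∀ b, ‖H1f i.1.1 i.1.2.1 i.1.2.2 i.2.2.le (c₀ L) (cB L) (a L i) (DeltaPiSlot i.1.1 i.1.2.1 i.1.2.2 i.2.2.le (c₀ L) (cB L) (a L i)) U₀ b‖ ≤ B₀ L * ‖b‖) :
    ∀ (L : ℕ), 1 < L → ∀ (i : Idx L) (U₀ : GaugeField (i.1.1.P i.1.2.2) 0 (Matrix.specialUnitaryGroup (Fin 2) ℂ)), RegPr i.1.1 i.1.2.1 i.1.2.2 (α L) U₀ →
      ∃ H : (PBond (i.1.1.P i.1.2.1) 0 → Matrix (Fin 2) (Fin 2) ℂ) →ₗ[ℂ] (PBond (i.1.1.P i.1.2.2) 0 → Matrix (Fin 2) (Fin 2) ℂ),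
        (∀ Y, QTwS i.1.1 i.1.2.1 i.1.2.2 i.2.2.le U₀ (H Y) = Y) ∧ (∀ Y, IsLandauPrintS i.1.1 i.1.2.1 i.1.2.2 i.2.2.le (c₀ L) (cB L) U₀ (H Y)) ∧
        (∀ Y, ‖H Y‖ ≤ B₀ L * eta i.1.1 i.1.2.1 i.1.2.2 * ‖Y‖) ∧
        (∀ Y, (∀ c, star (Y c) = -Y c ∧ (Y c).trace = 0) → ∀ b', star (H Y b') = -H Y b' ∧ (H Y b').trace = 0) := by
  intro L hL i U₀ hU
  obtain ⟨h1, h2, h3, -, h5⟩ := h46tw_letter_of_N06_normH hα hef hWe hWε hN06 norm_H L hL i U₀ hU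
  exact ⟨H46 i.1.1 i.1.2.1 i.1.2.2 i.2.2.le (c₀ L) (cB L) (a L i) U₀, h1, h2, h3, h5⟩

/-- ★★★ **`h46tw` WITH THE GRADIENT ROW (46)₁ INSIDE THE `∃ H`** (five clauses; ★px5 g0's cure (β) shape — the antecedent a repaired `hSize19′` would read for its order-1 member).
[cite: Balaban1985Variational, (45)–(46) p.285, (19) p.281, (115) p.294; Balaban1985BackgroundPropagators, Thm 3.11 p.418, (3.126) p.420, (3.133) p.422] -/
theorem h46twGrad_of_N06_normH (hα : ∀ L, 1 < L → 0 < α L) (hef : ∀ L, 1 < L → 0 < ef L)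
    (hWe : ∀ L : ℕ, 1 < L → 10 ^ 9 * (L : ℝ) ^ 2 * ef L ≤ 1) (hWε : ∀ L : ℕ, 1 < L → 10 ^ 12 * (L : ℝ) ^ 3 * α L ≤ 1)
    (hN06 : ∀ (L : ℕ), 1 < L → ∀ (i : Idx L) (U₀ : GaugeField (i.1.1.P i.1.2.2) 0 (Matrix.specialUnitaryGroup (Fin 2) ℂ)), RegPr i.1.1 i.1.2.1 i.1.2.2 (α L) U₀ →
      PosOnto i.1.1 i.1.2.1 i.1.2.2 i.2.2.le (c₀ L) (cB L) (a L i) (DeltaPiSlot i.1.1 i.1.2.1 i.1.2.2 i.2.2.le (c₀ L) (cB L) (a L i)) U₀ ∧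
      PosPrime i.1.1 i.1.2.1 i.1.2.2 i.2.2.le (c₀ L) (cB L) (a L i) U₀)
    (norm_H : ∀ (L : ℕ), 1 < L → ∀ (i : Idx L) (ρ : ℝ) (U₀ : GaugeField (i.1.1.P i.1.2.2) 0 (Matrix.specialUnitaryGroup (Fin 2) ℂ)),
      RegPr i.1.1 i.1.2.1 i.1.2.2 ρ U₀ → ρ ≤ α L →
        ∀ b, ‖H1f i.1.1 i.1.2.1 i.1.2.2 i.2.2.le (c₀ L) (cB L) (a L i) (DeltaPiSlot i.1.1 i.1.2.1 i.1.2.2 i.2.2.le (c₀ L) (cB L) (a L i)) U₀ b‖ ≤ B₀ L * ‖b‖) :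
    ∀ (L : ℕ), 1 < L → ∀ (i : Idx L) (U₀ : GaugeField (i.1.1.P i.1.2.2) 0 (Matrix.specialUnitaryGroup (Fin 2) ℂ)), RegPr i.1.1 i.1.2.1 i.1.2.2 (α L) U₀ →
      ∃ H : (PBond (i.1.1.P i.1.2.1) 0 → Matrix (Fin 2) (Fin 2) ℂ) →ₗ[ℂ] (PBond (i.1.1.P i.1.2.2) 0 → Matrix (Fin 2) (Fin 2) ℂ),
        (∀ Y, QTwS i.1.1 i.1.2.1 i.1.2.2 i.2.2.le U₀ (H Y) = Y) ∧ (∀ Y, IsLandauPrintS i.1.1 i.1.2.1 i.1.2.2 i.2.2.le (c₀ L) (cB L) U₀ (H Y)) ∧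
        (∀ Y, ‖H Y‖ ≤ B₀ L * eta i.1.1 i.1.2.1 i.1.2.2 * ‖Y‖) ∧
        (∀ (Y : PBond (i.1.1.P i.1.2.1) 0 → Matrix (Fin 2) (Fin 2) ℂ) (μ ν : Fin (i.1.1.P i.1.2.2).d) (x : Site (i.1.1.P i.1.2.2) 0),
          ‖covGradT 1 (bgUnits i.1.1 i.1.2.2 U₀) (H Y) μ ν x‖ ≤ B₀ L * eta i.1.1 i.1.2.1 i.1.2.2 ^ 2 * ‖Y‖) ∧
        (∀ Y, (∀ c, star (Y c) = -Y c ∧ (Y c).trace = 0) → ∀ b', star (H Y b') = -H Y b' ∧ (H Y b').trace = 0) := by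
  intro L hL i U₀ hU
  exact ⟨H46 i.1.1 i.1.2.1 i.1.2.2 i.2.2.le (c₀ L) (cB L) (a L i) U₀, h46tw_letter_of_N06_normH hα hef hWe hWε hN06 norm_H L hL i U₀ hU⟩

end Summit.QuantumFields.YangMills.Theorems.Prop7H46TwOfN06

end
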